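import Summits.Ventures.LatticeQCDFlow.Scaling.HomLadderSharpLaw

/-!
HONEST FRAMING: exact (Metropolis-corrected) sampling algorithms for lattice gauge theory; figures
of merit are autocorrelation/cost numbers at stated couplings and volumes; no continuum-physics
claim.

# CycleSharpLaw — THE RING THROUGH THE HOT SEAT: FOR THE CYCLE LIST `r ↦ (r, r+1)` ON `Fin (K+1)` (`m = K+1`, the ladder closed by the pair `(K, 0)`) THE GROUND STATE HAS
# `max{(K+1)(K²+2K+2)/(10t), (K+1)/h} ≤ 1/ρ ≤ max{K(K+1)²/t, 2(K+1)/h}` AND PARTICIPATION `Σc/√(Σc²) ≥ √((K+2)/12)`, HENCE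
# **`((1−ρ)/ρ)·log((1−ν(u))·√((K+2)/12)/4) ≤ t_mix(1/4) ≤ ⌈(1/ρ)·log(4h/ρ)⌉`** — `Θ(max{K³/t, K/h}·log K)` TWO-SIDED: CLOSING THE LADDER INTO A RING DOES NOT CHANGE THE ORDER
# (lean-2 GEN-48, ours)

Venture-side (OURS).  Cell `lqcd-flow` (pub-lqcd), unit `pub-lqcd-lean-2-g48`, 2026-08-31.  Chapter AI (the sizes of the Robin ground state), file 9 — parent AI6 `HomLadderSharpLaw`.  A topology
with no explicit ground state, sized entirely by the chapter's tools: (§1) power sums `Σk`, `Σk³`, `Σk⁴` over `ℝ` (`Σk²` is AI6's); (§2) the cycle list `e_r = (r, r+1)` (addition in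
`Fin (K+1)`, so `e_K = (K, 0)`): distinct endpoints for `K ≥ 1`, connected and with chains `0, 1, …, k` (through the adjacent sub-list `j ↦ e_{j}`, `j < K`, AI6), the PATH Poincaré
inequality of AI3 against the larger cycle energy gives `min{t/(K(K+1)²), h/(2(K+1))} ≤ ρ`, and the PARABOLA test vector `v_k = k(K+1−k)` — every listed difference is `±(K − 2r)`, energy
`tK(K+2)/3`, `Σv² = K(K+1)(K+2)(K²+2K+2)/30` — gives `ρ ≤ 10t/((K+1)(K²+2K+2))` (AI1's Rayleigh ceiling); AI2's participation bound with `L = K`, `m = K+1` and the two ceilings on `ρ`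
gives `Σc/√(Σc²) ≥ √((K+2)/12)`.  (§3) AI4's sharp law for `P = t·ptGraphSwap ν^{⊗} e 1 + (1−t)·prodKernel w M` on the cycle: **`((1−ρ)/ρ)·log((1−ν(u))√((K+2)/12)/4) ≤ t_mix(1/4) ≤
⌈(1/ρ)·log(4h/ρ)⌉` with `(K+1)(K²+2K+2)/(10t) ≤ 1/ρ`, `(K+1)/h ≤ 1/ρ`, `min{t/(K(K+1)²), h/(2(K+1))} ≤ ρ`** — the same `Θ(max{K³/t, K/h}·log K)` as the ladder (AI6: floor unit
`K(K+1)(2K+1)/(6t)`), the ring's transport unit between `K³/(10t)` and `K³/t`.  No definitions.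

* §1 `sum_range_id_real`, `sum_range_cube_real`, `sum_range_four_real`; §2 `cycleList_ne`, `cycleList_castSucc`, `cycleList_connected`, `cycleList_reachable`, `cycleList_poincare`,
  `cycleList_rho_ge`, `cycleList_parabola_edge`, `cycleList_rho_le_parabola`, `cycleList_participation_ge`; §3 `homCycle_sharp_two_sided`.

Literature grade (cell rule): OWN; nothing cited; no new bib keys.
-/

noncomputable section

open Finset Function Real
open Literature.Probability.MarkovChains

namespace Summit.Ventures.LatticeQCDFlow.Scaling

variable {S : Type*} [Fintype S] [DecidableEq S] {K : ℕ} {ν : S → ℝ} {M : Fin (K + 1) → S → S → ℝ} {w : Fin (K + 1) → ℝ} {t : ℝ}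
  {P : (Fin (K + 1) → S) → (Fin (K + 1) → S) → ℝ}

/-! ## §1 Power sums -/

omit [Fintype S] [DecidableEq S] in
/-- `Σ_{k≤K}k = K(K+1)/2` over `ℝ`. [ours] -/
theorem sum_range_id_real (K : ℕ) : ∑ k ∈ range (K + 1), ((k : ℝ)) = (K : ℝ) * (K + 1) / 2 := by
  induction K with
  | zero => simp
  | succ n ih => rw [Finset.sum_range_succ, ih]; push_cast; ring

omit [Fintype S] [DecidableEq S] in
/-- `Σ_{k≤K}k³ = K²(K+1)²/4` over `ℝ`. [ours] -/
theorem sum_range_cube_real (K : ℕ) : ∑ k ∈ range (K + 1), ((k : ℝ)) ^ 3 = (K : ℝ) ^ 2 * (K + 1) ^ 2 / 4 := by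
  induction K with
  | zero => simp
  | succ n ih => rw [Finset.sum_range_succ, ih]; push_cast; ring

omit [Fintype S] [DecidableEq S] in
/-- `Σ_{k≤K}k⁴ = K(K+1)(2K+1)(3K²+3K−1)/30` over `ℝ`. [ours] -/
theorem sum_range_four_real (K : ℕ) : ∑ k ∈ range (K + 1), ((k : ℝ)) ^ 4 = (K : ℝ) * (K + 1) * (2 * K + 1) * (3 * K ^ 2 + 3 * K - 1) / 30 := by
  induction K with
  | zero => simp
  | succ n ih => rw [Finset.sum_range_succ, ih]; push_cast; ring

/-! ## §2 The cycle list -/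

omit [Fintype S] [DecidableEq S] in
/-- The cycle list has distinct endpoints for `K ≥ 1`: `r ≠ r + 1` in `Fin (K+1)`. [ours] -/
theorem cycleList_ne (hK : 1 ≤ K) (r : Fin (K + 1)) :
    ((fun r : Fin (K + 1) => ((r, r + 1) : Fin (K + 1) × Fin (K + 1))) r).1 ≠ ((fun r : Fin (K + 1) => ((r, r + 1) : Fin (K + 1) × Fin (K + 1))) r).2 := by
  dsimp only
  intro h
  have hv := congrArg Fin.val h
  rw [Fin.val_add_one] at hv
  split_ifs at hv with hl
  · rw [hl, Fin.val_last] at hv; omega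
  · omega

omit [Fintype S] [DecidableEq S] in
/-- The adjacent pairs are cycle entries: `e_{j.castSucc} = (j.castSucc, j.succ)` for `j < K`. [ours] -/
theorem cycleList_castSucc (j : Fin K) :
    (fun r : Fin (K + 1) => ((r, r + 1) : Fin (K + 1) × Fin (K + 1))) j.castSucc = (j.castSucc, j.succ) := by
  dsimp only
  rw [Fin.coeSucc_eq_succ]

omit [Fintype S] [DecidableEq S] in
/-- **The cycle list is connected.** [ours] -/
theorem cycleList_connected (A : Finset (Fin (K + 1))) (hA : A.Nonempty) (hAu : A ≠ univ) :
    ∃ r : Fin (K + 1), (((fun r : Fin (K + 1) => ((r, r + 1) : Fin (K + 1) × Fin (K + 1))) r).1 ∈ A ∧ ((fun r : Fin (K + 1) => ((r, r + 1) : Fin (K + 1) × Fin (K + 1))) r).2 ∉ A)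
      ∨ (((fun r : Fin (K + 1) => ((r, r + 1) : Fin (K + 1) × Fin (K + 1))) r).2 ∈ A ∧ ((fun r : Fin (K + 1) => ((r, r + 1) : Fin (K + 1) × Fin (K + 1))) r).1 ∉ A) := by
  obtain ⟨j, hj⟩ := pathList_connected A hA hAu
  refine ⟨j.castSucc, ?_⟩
  rw [cycleList_castSucc]
  exact hj

omit [Fintype S] [DecidableEq S] in
/-- **Every level is within `K` cycle pairs of the hot one** (the chains `0, 1, …, k`). [ours] -/
theorem cycleList_reachable (k : Fin (K + 1)) :
    ∃ n : ℕ, n ≤ K ∧ ∃ γ : Fin (n + 1) → Fin (K + 1), γ 0 = 0 ∧ γ (Fin.last n) = k ∧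
      ∀ j : Fin n, ∃ r : Fin (K + 1), (((fun r : Fin (K + 1) => ((r, r + 1) : Fin (K + 1) × Fin (K + 1))) r).1 = γ j.castSucc ∧ ((fun r : Fin (K + 1) => ((r, r + 1) : Fin (K + 1) × Fin (K + 1))) r).2 = γ j.succ)
        ∨ (((fun r : Fin (K + 1) => ((r, r + 1) : Fin (K + 1) × Fin (K + 1))) r).1 = γ j.succ ∧ ((fun r : Fin (K + 1) => ((r, r + 1) : Fin (K + 1) × Fin (K + 1))) r).2 = γ j.castSucc) := by
  obtain ⟨n, hn, γ, hγ0, hγk, hγ⟩ := pathList_reachable (K := K) k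
  refine ⟨n, hn, γ, hγ0, hγk, fun j => ?_⟩
  obtain ⟨r, hr⟩ := hγ j
  refine ⟨r.castSucc, ?_⟩
  rw [cycleList_castSucc]
  exact hr

omit [Fintype S] [DecidableEq S] in
/-- **The cycle's Poincaré inequality (through the adjacent sub-list):** `Σ_kv_k² ≤ K(K+1)·Σ_r(v_{e_r.1} − v_{e_r.2})² + 2(K+1)·v_0²`. [ours] -/
theorem cycleList_poincare (v : Fin (K + 1) → ℝ) :
    ∑ k : Fin (K + 1), v k ^ 2 ≤ (K : ℝ) * (K + 1) * ∑ r : Fin (K + 1), (v ((fun r : Fin (K + 1) => ((r, r + 1) : Fin (K + 1) × Fin (K + 1))) r).1 - v ((fun r : Fin (K + 1) => ((r, r + 1) : Fin (K + 1) × Fin (K + 1))) r).2) ^ 2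
      + 2 * ((K : ℝ) + 1) * v 0 ^ 2 := by
  have hpath := path_poincare_fin v
  have hsub : ∑ j : Fin K, (v j.castSucc - v j.succ) ^ 2
      ≤ ∑ r : Fin (K + 1), (v ((fun r : Fin (K + 1) => ((r, r + 1) : Fin (K + 1) × Fin (K + 1))) r).1 - v ((fun r : Fin (K + 1) => ((r, r + 1) : Fin (K + 1) × Fin (K + 1))) r).2) ^ 2 := by
    have : ∑ j : Fin K, (v j.castSucc - v j.succ) ^ 2
        = ∑ r ∈ univ.map ⟨(Fin.castSucc : Fin K → Fin (K + 1)), Fin.castSucc_injective K⟩,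
            (v ((fun r : Fin (K + 1) => ((r, r + 1) : Fin (K + 1) × Fin (K + 1))) r).1 - v ((fun r : Fin (K + 1) => ((r, r + 1) : Fin (K + 1) × Fin (K + 1))) r).2) ^ 2 := by
      rw [sum_map]
      refine sum_congr rfl fun j _ => ?_
      simp only [Function.Embedding.coeFn_mk]
      rw [Fin.coeSucc_eq_succ]
    rw [this]
    exact sum_le_univ_sum_of_nonneg fun r => sq_nonneg _
  have hK0 : (0 : ℝ) ≤ (K : ℝ) * (K + 1) := by positivity
  nlinarith [mul_le_mul_of_nonneg_left hsub hK0]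

omit [Fintype S] [DecidableEq S] in
/-- **THE CYCLE'S RATE FLOOR: `min{t/(K(K+1)²), h/(2(K+1))} ≤ ρ`** for a positive solution (`K ≥ 1`, `t, h > 0`). [ours] -/
theorem cycleList_rho_ge (hK : 1 ≤ K) (ht : 0 < t) {h ρ : ℝ} (hh : 0 < h) {c : Fin (K + 1) → ℝ} (hc : ∀ k, 0 < c k)
    (hvertex : ∀ k : Fin (K + 1), t / ((K + 1 : ℕ) : ℝ) * ∑ r : Fin (K + 1), ((if k = ((fun r : Fin (K + 1) => ((r, r + 1) : Fin (K + 1) × Fin (K + 1))) r).1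
        then c ((fun r : Fin (K + 1) => ((r, r + 1) : Fin (K + 1) × Fin (K + 1))) r).2 - c ((fun r : Fin (K + 1) => ((r, r + 1) : Fin (K + 1) × Fin (K + 1))) r).1 else 0)
      + (if k = ((fun r : Fin (K + 1) => ((r, r + 1) : Fin (K + 1) × Fin (K + 1))) r).2
        then c ((fun r : Fin (K + 1) => ((r, r + 1) : Fin (K + 1) × Fin (K + 1))) r).1 - c ((fun r : Fin (K + 1) => ((r, r + 1) : Fin (K + 1) × Fin (K + 1))) r).2 else 0))
      - (if k = 0 then h * c k else 0) = -ρ * c k) :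
    min (t / ((K : ℝ) * (K + 1) ^ 2)) (h / (2 * ((K : ℝ) + 1))) ≤ ρ := by
  have hKpos : (0 : ℝ) < K := Nat.cast_pos.mpr (by omega)
  have h := groundState_rho_ge_min (fun r : Fin (K + 1) => ((r, r + 1) : Fin (K + 1) × Fin (K + 1))) (by omega) ht hh hc hvertex
    (a := (K : ℝ) * (K + 1)) (b := 2 * ((K : ℝ) + 1)) (by positivity) (by positivity) cycleList_poincare
  have heq : t / ((K : ℝ) * (K + 1) * ((K + 1 : ℕ) : ℝ)) = t / ((K : ℝ) * (K + 1) ^ 2) := by push_cast; ring_nf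
  rw [heq] at h
  exact h

omit [Fintype S] [DecidableEq S] in
/-- **The parabola on the cycle:** with `v_k = k(K+1−k)` every listed difference squares to `(K − 2r)²` (the pair `(K, 0)` included). [ours] -/
theorem cycleList_parabola_edge (r : Fin (K + 1)) :
    ((((r : ℕ) : ℝ)) * ((K : ℝ) + 1 - ((r : ℕ) : ℝ)) - ((((r + 1 : Fin (K + 1)) : ℕ) : ℝ)) * ((K : ℝ) + 1 - (((r + 1 : Fin (K + 1)) : ℕ) : ℝ))) ^ 2
      = ((K : ℝ) - 2 * ((r : ℕ) : ℝ)) ^ 2 := by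
  rw [Fin.val_add_one]
  split_ifs with hl
  · rw [hl, Fin.val_last]; push_cast; ring
  · push_cast; ring

omit [Fintype S] [DecidableEq S] in
/-- **The parabola test vector on the cycle:** a positive solution (`t ≥ 0`, `K ≥ 1`) has `ρ ≤ 10t/((K+1)(K²+2K+2))`. [ours] -/
theorem cycleList_rho_le_parabola (hK : 1 ≤ K) (ht : 0 ≤ t) {h ρ : ℝ} {c : Fin (K + 1) → ℝ} (hc : ∀ k, 0 < c k)
    (hvertex : ∀ k : Fin (K + 1), t / ((K + 1 : ℕ) : ℝ) * ∑ r : Fin (K + 1), ((if k = ((fun r : Fin (K + 1) => ((r, r + 1) : Fin (K + 1) × Fin (K + 1))) r).1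
        then c ((fun r : Fin (K + 1) => ((r, r + 1) : Fin (K + 1) × Fin (K + 1))) r).2 - c ((fun r : Fin (K + 1) => ((r, r + 1) : Fin (K + 1) × Fin (K + 1))) r).1 else 0)
      + (if k = ((fun r : Fin (K + 1) => ((r, r + 1) : Fin (K + 1) × Fin (K + 1))) r).2
        then c ((fun r : Fin (K + 1) => ((r, r + 1) : Fin (K + 1) × Fin (K + 1))) r).1 - c ((fun r : Fin (K + 1) => ((r, r + 1) : Fin (K + 1) × Fin (K + 1))) r).2 else 0))
      - (if k = 0 then h * c k else 0) = -ρ * c k) :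
    ρ ≤ 10 * t / (((K : ℝ) + 1) * ((K : ℝ) ^ 2 + 2 * K + 2)) := by
  have hKpos : (0 : ℝ) < K := Nat.cast_pos.mpr (by omega)
  have hr := groundState_rayleigh (fun r : Fin (K + 1) => ((r, r + 1) : Fin (K + 1) × Fin (K + 1))) hc ht hvertex (fun k => ((k : ℕ) : ℝ) * ((K : ℝ) + 1 - ((k : ℕ) : ℝ)))
  dsimp only at hr
  simp only [cycleList_parabola_edge] at hr
  -- the energy: `Σ_r(K − 2r)² = K(K+1)(K+2)/3`
  have hE : ∑ r : Fin (K + 1), ((K : ℝ) - 2 * ((r : ℕ) : ℝ)) ^ 2 = (K : ℝ) * (K + 1) * (K + 2) / 3 := by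
    rw [Fin.sum_univ_eq_sum_range (fun i => ((K : ℝ) - 2 * ((i : ℕ) : ℝ)) ^ 2) (K + 1)]
    have hex : ∀ i : ℕ, ((K : ℝ) - 2 * (i : ℝ)) ^ 2 = (K : ℝ) ^ 2 - 4 * K * (i : ℝ) + 4 * (i : ℝ) ^ 2 := fun i => by ring
    simp_rw [hex, sum_add_distrib, sum_sub_distrib, ← mul_sum, sum_const, card_range, nsmul_eq_mul, sum_range_id_real, sum_range_sq_real]
    push_cast; ring
  -- the norm: `Σ_k k²(K+1−k)² = K(K+1)(K+2)(K²+2K+2)/30`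
  have hV : ∑ k : Fin (K + 1), (((k : ℕ) : ℝ) * ((K : ℝ) + 1 - ((k : ℕ) : ℝ))) ^ 2 = (K : ℝ) * (K + 1) * (K + 2) * ((K : ℝ) ^ 2 + 2 * K + 2) / 30 := by
    rw [Fin.sum_univ_eq_sum_range (fun i => (((i : ℕ) : ℝ) * ((K : ℝ) + 1 - ((i : ℕ) : ℝ))) ^ 2) (K + 1)]
    have hex : ∀ i : ℕ, (((i : ℝ)) * ((K : ℝ) + 1 - (i : ℝ))) ^ 2 = ((K : ℝ) + 1) ^ 2 * (i : ℝ) ^ 2 - 2 * ((K : ℝ) + 1) * (i : ℝ) ^ 3 + (i : ℝ) ^ 4 := fun i => by ring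
    simp_rw [hex, sum_add_distrib, sum_sub_distrib, ← mul_sum, sum_range_sq_real, sum_range_cube_real, sum_range_four_real]
    ring
  rw [hE, hV, Fin.val_zero, Nat.cast_zero] at hr
  have h0 : ((0 : ℝ) * ((K : ℝ) + 1 - 0)) ^ 2 = 0 := by ring
  rw [h0, mul_zero, add_zero] at hr
  have hm : t / ((K + 1 : ℕ) : ℝ) * ((K : ℝ) * (K + 1) * (K + 2) / 3) = t * K * (K + 2) / 3 := by push_cast; field_simp
  rw [hm] at hr
  rw [le_div_iff₀ (by positivity)]
  nlinarith [hr, hKpos]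

omit [Fintype S] [DecidableEq S] in
/-- **THE PARTICIPATION OF THE CYCLE'S GROUND STATE: `√((K+2)/12) ≤ Σc/√(Σc²)`** (positive solution, `ρ > 0`, `K ≥ 1`, `t, h > 0`). [ours] -/
theorem cycleList_participation_ge (hK : 1 ≤ K) (ht : 0 < t) {h ρ : ℝ} (hh : 0 < h) (hρ : 0 < ρ) {c : Fin (K + 1) → ℝ} (hc : ∀ k, 0 < c k)
    (hvertex : ∀ k : Fin (K + 1), t / ((K + 1 : ℕ) : ℝ) * ∑ r : Fin (K + 1), ((if k = ((fun r : Fin (K + 1) => ((r, r + 1) : Fin (K + 1) × Fin (K + 1))) r).1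
        then c ((fun r : Fin (K + 1) => ((r, r + 1) : Fin (K + 1) × Fin (K + 1))) r).2 - c ((fun r : Fin (K + 1) => ((r, r + 1) : Fin (K + 1) × Fin (K + 1))) r).1 else 0)
      + (if k = ((fun r : Fin (K + 1) => ((r, r + 1) : Fin (K + 1) × Fin (K + 1))) r).2
        then c ((fun r : Fin (K + 1) => ((r, r + 1) : Fin (K + 1) × Fin (K + 1))) r).1 - c ((fun r : Fin (K + 1) => ((r, r + 1) : Fin (K + 1) × Fin (K + 1))) r).2 else 0))
      - (if k = 0 then h * c k else 0) = -ρ * c k) :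
    Real.sqrt (((K : ℝ) + 2) / 12) ≤ (∑ k : Fin (K + 1), c k) / Real.sqrt (∑ k : Fin (K + 1), c k ^ 2) := by
  have hKpos : (0 : ℝ) < K := Nat.cast_pos.mpr (by omega)
  have hpart := groundState_participation_ge (fun r : Fin (K + 1) => ((r, r + 1) : Fin (K + 1) × Fin (K + 1))) (by omega) ht hρ hc hvertex K cycleList_reachable
  refine le_trans (Real.sqrt_le_sqrt ?_) hpart
  have hpar := cycleList_rho_le_parabola hK ht.le hc hvertex
  have hhot := groundState_rho_le_hot (fun r : Fin (K + 1) => ((r, r + 1) : Fin (K + 1) × Fin (K + 1))) hc ht.le hvertex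
  have hm : (((K + 1 : ℕ) : ℝ)) = (K : ℝ) + 1 := by push_cast; ring
  rw [hm]
  have hq : 0 < 1 + (K : ℝ) * (((K : ℝ) + 1) * h / t) := by positivity
  rw [div_le_div_iff₀ (by norm_num) (mul_pos hρ hq)]
  have hexp : ((K : ℝ) + 2) * (ρ * (1 + (K : ℝ) * (((K : ℝ) + 1) * h / t))) = ((K : ℝ) + 2) * ρ + ((K : ℝ) + 2) * ρ * K * (K + 1) * h / t := by ring
  rw [hexp]
  have h1 : ((K : ℝ) + 2) * ρ ≤ 2 * h := by nlinarith
  have h2 : ((K : ℝ) + 2) * ρ * K * (K + 1) * h / t ≤ 10 * h := by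
    rw [div_le_iff₀ ht]
    rcases le_or_gt ((K : ℝ) * (K + 1) * h) t with hsmall | hlarge
    · have : ((K : ℝ) + 2) * ρ * K * (K + 1) * h = (((K : ℝ) + 2) * ρ) * ((K : ℝ) * (K + 1) * h) := by ring
      rw [this]
      calc (((K : ℝ) + 2) * ρ) * ((K : ℝ) * (K + 1) * h) ≤ (2 * h) * t := mul_le_mul h1 hsmall (by positivity) (by positivity)
        _ ≤ 10 * h * t := by nlinarith
    · have hρ' : ρ * (((K : ℝ) + 1) * ((K : ℝ) ^ 2 + 2 * K + 2)) ≤ 10 * t := by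
        have := hpar; rwa [le_div_iff₀ (by positivity)] at this
      have hstep : ((K : ℝ) + 2) * ρ * K * (K + 1) * h * ((K : ℝ) ^ 2 + 2 * K + 2) ≤ 10 * t * ((K + 2) * K * h) := by
        have : ((K : ℝ) + 2) * ρ * K * (K + 1) * h * ((K : ℝ) ^ 2 + 2 * K + 2) = (ρ * (((K : ℝ) + 1) * ((K : ℝ) ^ 2 + 2 * K + 2))) * ((K + 2) * K * h) := by ring
        rw [this]; exact mul_le_mul_of_nonneg_right hρ' (by positivity)
      nlinarith [hstep, mul_pos hKpos hh, mul_pos (mul_pos hKpos hh) ht, mul_pos (mul_pos (mul_pos hKpos hh) ht) hKpos]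
  linarith

/-! ## §3 The sharp law on the ring -/

/-- **THE HOMOGENEOUS EXCHANGE SCHEME ON THE RING THROUGH THE HOT SEAT:** `K ≥ 1`, `0 < t < 1`, `w` a probability vector with `w_0 > 0`, one positive law `ν`, exact hot sampler, idle cold
kernels, `P = t·ptGraphSwap ν^{⊗} (r ↦ (r, r+1)) 1 + (1−t)·prodKernel w M`, `h = (1−t)w_0`; then there is `ρ` with `(K+1)(K²+2K+2)/(10t) ≤ 1/ρ`, `(K+1)/h ≤ 1/ρ`,
`min{t/(K(K+1)²), h/(2(K+1))} ≤ ρ` and, for every content `u`, **`((1−ρ)/ρ)·log((1−ν(u))·√((K+2)/12)/4) ≤ t_mix(1/4) ≤ ⌈(1/ρ)·log(4h/ρ)⌉`**. [ours] -/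
theorem homCycle_sharp_two_sided (hK : 1 ≤ K) (hν : ∀ v, 0 < ν v) (hν1 : ∑ v, ν v = 1) (hM0 : ∀ u v, M 0 u v = ν v)
    (hidle : ∀ i : Fin K, ∀ u v, M i.succ u v = if v = u then 1 else 0) (hw0 : ∀ k, 0 ≤ w k) (hw00 : 0 < w 0) (hw1 : ∑ k, w k = 1) (ht0 : 0 < t) (ht1 : t < 1)
    (hP : ∀ x y, P x y = t * ptGraphSwap (fun _ : Fin (K + 1) => ν) (fun r : Fin (K + 1) => ((r, r + 1) : Fin (K + 1) × Fin (K + 1))) (fun _ => Equiv.refl S) x y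
      + (1 - t) * prodKernel w M x y) (u : S) :
    ∃ ρ : ℝ, 0 < ρ ∧ ((K : ℝ) + 1) * ((K : ℝ) ^ 2 + 2 * K + 2) / (10 * t) ≤ 1 / ρ ∧ ((K : ℝ) + 1) / ((1 - t) * w 0) ≤ 1 / ρ ∧
      min (t / ((K : ℝ) * (K + 1) ^ 2)) ((1 - t) * w 0 / (2 * ((K : ℝ) + 1))) ≤ ρ ∧
      (1 - ρ) / ρ * Real.log ((1 - ν u) * Real.sqrt (((K : ℝ) + 2) / 12) / 4) ≤ (mixingTime P (tensorFun (fun _ : Fin (K + 1) => ν)) (1 / 4) : ℝ) ∧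
      mixingTime P (tensorFun (fun _ : Fin (K + 1) => ν)) (1 / 4) ≤ ⌈1 / ρ * Real.log (4 * ((1 - t) * w 0) / ρ)⌉₊ := by
  have hKpos : (0 : ℝ) < K := Nat.cast_pos.mpr (by omega)
  have hhh : 0 < (1 - t) * w 0 := mul_pos (by linarith) hw00
  have he := cycleList_ne hK
  obtain ⟨c, ρ, hcpos, hcS, hρ0, hρle, hvertex⟩ := graph_groundState_exists (fun r : Fin (K + 1) => ((r, r + 1) : Fin (K + 1) × Fin (K + 1))) (t := t) (h := (1 - t) * w 0)
    (by omega) ht0 hhh cycleList_connected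
  have htwo := graphScheme_sharp_two_sided_mode (fun r : Fin (K + 1) => ((r, r + 1) : Fin (K + 1) × Fin (K + 1))) (by omega) he hν hν1 hM0 hidle hw0 hw00 hw1 ht0 ht1 hP
    hρ0 hcpos hvertex u
  have hpar := cycleList_rho_le_parabola hK ht0.le hcpos hvertex
  have hfloorρ := cycleList_rho_ge hK ht0 hhh hcpos hvertex
  have hpart := cycleList_participation_ge hK ht0 hhh hρ0 hcpos hvertex
  have hρ1 : ρ < 1 := by
    have hw01 : w 0 ≤ 1 := by
      calc w 0 ≤ ∑ k, w k := Finset.single_le_sum (fun k _ => hw0 k) (mem_univ 0)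
        _ = 1 := hw1
    have : (1 - t) * w 0 / ((K : ℝ) + 1) ≤ (1 - t) * w 0 := div_le_self hhh.le (by linarith)
    nlinarith
  refine ⟨ρ, hρ0, ?_, ?_, hfloorρ, le_trans ?_ htwo.1, htwo.2⟩
  · rw [div_le_div_iff₀ (by positivity) hρ0, one_mul]
    have := hpar
    rw [le_div_iff₀ (by positivity)] at this
    linarith
  · rw [div_le_div_iff₀ hhh hρ0, one_mul]
    calc ((K : ℝ) + 1) * ρ ≤ ((K : ℝ) + 1) * ((1 - t) * w 0 / ((K : ℝ) + 1)) := mul_le_mul_of_nonneg_left hρle (by linarith)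
      _ = (1 - t) * w 0 := by field_simp
  · have hνu : ν u ≤ 1 := by
      calc ν u ≤ ∑ v, ν v := Finset.single_le_sum (fun v _ => (hν v).le) (mem_univ u)
        _ = 1 := hν1
    have hcoef : 0 ≤ (1 - ρ) / ρ := div_nonneg (by linarith) hρ0.le
    rcases eq_or_lt_of_le hνu with heq | hlt
    · rw [heq]; simp
    · have hA : 0 < (1 - ν u) * Real.sqrt (((K : ℝ) + 2) / 12) / 4 := by
        have : 0 < Real.sqrt (((K : ℝ) + 2) / 12) := Real.sqrt_pos.mpr (by positivity)
        have : 0 < 1 - ν u := by linarith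
        positivity
      refine floorLog_mono hcoef hA ?_
      have h4 : (1 - ν u) * Real.sqrt (((K : ℝ) + 2) / 12) / 4 = (1 - ν u) / 4 * Real.sqrt (((K : ℝ) + 2) / 12) := by ring
      have h5 : (1 - ν u) * (∑ k : Fin (K + 1), c k) / (4 * Real.sqrt (∑ k : Fin (K + 1), c k ^ 2))
          = (1 - ν u) / 4 * ((∑ k : Fin (K + 1), c k) / Real.sqrt (∑ k : Fin (K + 1), c k ^ 2)) := by ring
      rw [h4, h5]
      exact mul_le_mul_of_nonneg_left hpart (by linarith)

end Summit.Ventures.LatticeQCDFlow.Scaling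

end
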